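import Literature.MathematicalPhysics.QuantumFieldTheory.Balaban1983to89.B16NodeKnitRecord5C

/-!
# `Balaban1983to89.B16NodeKnitSocket` — YM-DAG node N13 · [Balaban1989LargeFieldII] CMP **122** (1989) 355–392, Theorem 1 p. 355 + (0.1),
# Cor. 3 pp. 387 ∕ 391: the STAGE-AGNOSTIC SOCKET of the N13 knit — N13 and the threshold-`S_N13E` child over an ARBITRARY record predicate with
# the construction clause `Rec D w → w.C = D.C`, from the 𝐑-leaf at the record worlds and the POINTWISE (0.1) AT THE DATUM'S CONSTRUCTION below a
# datum-indexed threshold (the output shape of the cell's Cor.-3 chain); instantiated at the predicate of record `IsRecordOfRecord₅C`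

statement-level bookkeeping over published theorems with citation tags; kernel-checked compositions of tree theorems;
nothing here is a claim about the Yang–Mills mass gap.

CITATION HEADER (lean-in-tree rule).  Source: T. Bałaban, *Large field renormalization. II. Localization, exponentiation, and bounds for the
𝐑 operation*, Commun. Math. Phys. **122**, 355–392 (1989), doi:10.1007/bf01238433 [Balaban1989LargeFieldII] (cell paper B16 = «[V]»), with
[Balaban1988Convergent] («[III]», the assumed 𝐑 of p. 244, Cor. 3 (2.50) p. 264).  Seat `pub-ymgap-dag-n13-a` (YM-PLAN Track A, HUMAN RULING D-0062:
the KNIT-BY-NAME seat of node N13; director-ym LINE №12), module 7 of the seat.  BY NAME and UNCHANGED: `…B16NodeKnitRecord5` (module 5: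
`b16_main_of_rOperation_of_uvSlot`), `…B16NodeKnitRecord5C` (module 6: `rOperation_iff_rOpLeaf_res₅C`), `…Node00.Record5C` (`IsRecordOfRecord₅C`,
`construction_eq_of_isRecordOfRecord₅C`), `…B16` (`UVIneq`, `uvIneq_of_le`, `SignConventions`), `…B14Cor3` (`inInterval_of_le`), `…Dag` (`B16_main` :253),
`…DagBinding` (`leavesP`, `WorldP`, `ROpLeaf`).

WHY STAGE-AGNOSTIC (pub-ymgap chair R437, 2026-08-25: NODE 00's record chain will be RE-BASED at stage ₉ — densities of record := the explicit
represented tower `eval rep_k`, (0.1)∕(2.50) faces typed POINTWISE over them; no face over ₇C∕₈C's `rnTransport` densities).  Modules 5–6 knit N13 at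
`IsRecordOfRecord₅ ∕ ₅C` through the Stage-5 PARAMETERS (`densOfRecord₅ θ`, `θ.res.χ`, …).  This module states the same knit ONE LEVEL UP, over ANY record
predicate `Rec : FiniteEpsData F (SU N) → WorldP → Prop` whose worlds carry the datum's construction (`Rec D w → w.C = D.C` — the binding clause every
stage of the chain has and keeps), reading the Cor.-3 slot AT THE DATUM'S CONSTRUCTION `D.C` abstractly: `(D.C P).flow`, `(D.C P).Sect2Form k`,
`(D.C P).Cfg k`, `B16.UVIneq (D.C P) k V …` — pointwise, as print has it ([V] p. 356 l. 1 *"with the constants E₋, E₊ independent of k, T_η, U_k"*), and as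
the cell's Cor.-3 chain delivers it one run, one step (`B16Cor3CurlyGas.uvIneq_of_repr172_torus_of_ineq249_of_gas`, `B16Improved189FullBudget`).  Whatever
stage carries the densities (₅C today, ₉C's represented tower tomorrow), the socket is the same two hypotheses: (R) the 𝐑-leaf `(w.up P).rOperation` at
every record world; (UV) the pointwise (0.1) at `D.C` below a datum-indexed threshold `γ₁ D` with datum-indexed exponent functions `e∓ D` — or DOMINATED
explicit constants per step, given the sign convention `χ_k ≥ 0` of `D.C` (`B16.uvIneq_of_le`).

WHAT THIS FILE PROVES (0 `sorry`, 0 `def`, standard axioms).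
§1 World level (any `w`, any binding): `uvSlot_of_direct` (N13's Cor.-3 slot at `(w, P)` from the pointwise (0.1) at `w.C P` with the world's exponent
   functions on `]0, γ₁] ∋ w.γ`), `uvSlot_of_dominated` (from dominated per-step constants, given `χ_k ≥ 0`), `b16_main_of_rOperation_of_direct` ∕
   `_of_dominated` (N13 at `(w, P)` with the 𝐑-leaf).
§2 Over an ARBITRARY record predicate with the construction clause: **`s_N13E_threshold_shape_of_direct`** — the recommended child text
   `∀ D, (∃ w, Rec D w) → ∃ γ₁ > 0, ∃ em ep, ∀ w, Rec D w → w.γ ≤ γ₁ → w.em = em → w.ep = ep → ∀ P, Dag.B16_main (leavesP w P)` from (R) + (UV) direct;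
   `s_N13E_threshold_shape_of_dominated` (from (R) + dominated constants + `B16.SignConventions D.C`); `b16_main_at_record_of_direct` (one world).
§3 At the predicate of record `IsRecordOfRecord₅C` (construction clause = `Node00.construction_eq_of_isRecordOfRecord₅C`): `rOperation_of_isRecordOfRecord₅C`
   ((R) from (R₅) `∀ θ adm, ∀ P, ROpLeaf (θ.res.V P)` on the residual 𝐑-carriers), **`s_N13E_threshold_shape_of_direct₅C_at_datum`**,
   `s_N13E_threshold_shape_of_dominated₅C_at_datum`.
§4 FITNESS CHECK of the recommended child against binder B2's glue (design E; the glue of record is N24's ∕ the dagwriter's `B2_at_recordE`):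
   **`endStatementBPrinted_at_record_of_threshold_child`** — over any record predicate that binds the construction and is re-letterable in `(γ, b, β⁺, e₋, e₊)`,
   N01–N12 at every record world + the THRESHOLD `S_N13E` child + the β-window existential at the datum + guarded (0.20) ⇒ `B16.EndStatementBPrinted D.C` at
   every record (re-letter to `γ := min γ₀ γ₁`); `isRecordOfRecord₅C_withLetters`; `endStatementBPrinted_of_isRecordOfRecord₅C_of_threshold_child` (at the
   predicate of record, where (0.20) and re-letterability are theorems).

HONEST FRAMING.  A count-neutral SLOT landing (R429 (4)(i)): N13 is NOT discharged — (R) = [Balaban1989LargeFieldII] Thm 1 for 𝐑 and (UV) = (0.1) ∕ Cor. 3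
pointwise at the datum's construction are displayed HYPOTHESES (what the paper proves, pp. 356–391 and p. 387); nothing of Bałaban's asserted or proved
here; one finite four-torus programme at fixed `ε`, Bałaban AS PRINTED with locators; nothing continuum ∕ ℝ⁴ ∕ OS ∕ mass gap ∕ Clay.
-/

noncomputable section

namespace Literature.MathematicalPhysics.QuantumFieldTheory.Balaban1983to89.B16NodeKnitSocket

open DagBinding T4Continuum Node00
open B16NodeKnitRecord5 (b16_main_of_rOperation_of_uvSlot)
open B16NodeKnitRecord5C (rOperation_iff_rOpLeaf_res₅C)

/-! ## §1. World level: the pointwise (0.1) at `w.C P` ⇒ N13's Cor.-3 slot ⇒ N13 (with the 𝐑-leaf) -/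

section World

variable (w : WorldP) (P : B12.RunParams)

/-- **THE DIRECT SOCKET (world level)**: if `w.γ ≤ γ₁` and the POINTWISE two-sided inequality `B16.UVIneq (w.C P) k V (w.em g_k) (w.ep g_k)` holds for every
`k ≤ K` and every configuration `V` under the interval hypothesis on `]0, γ₁]` and the §2-description guard at step `k`, then N13's Cor.-3 slot «(interval ⇒
§2 description) ⇒ (interval ⇒ `uvBounds`)» holds at `(w, P)` ([V] p. 387: *"This implies the inequality (2.50) [III], hence Corollary 3."*; the interval
hypothesis on `]0, w.γ]` implies the one on `]0, γ₁]`, `B14Cor3.inInterval_of_le`).  HYPOTHESIS; count-neutral. [cite: Balaban1989LargeFieldII, (0.1) pp.355–356, p.387; Balaban1988Convergent, Cor. 3 (2.50) p.264] -/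
theorem uvSlot_of_direct {γ₁ : ℝ} (hγ : w.γ ≤ γ₁)
    (hUV : (w.C P).flow.InInterval γ₁ P.K → ∀ k, k ≤ P.K → (w.C P).Sect2Form k → ∀ V : (w.C P).Cfg k,
      B16.UVIneq (w.C P) k V (w.em ((w.C P).flow.g k)) (w.ep ((w.C P).flow.g k))) :
    ((leavesP w P).smallCouplings → (leavesP w P).densitiesDescribed) →
      ((leavesP w P).smallCouplings → (leavesP w P).uvBounds) :=
  fun hdd hsc k hk V => hUV (B14Cor3.inInterval_of_le hsc hγ) k hk (hdd hsc k hk) V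

/-- **THE DOMINATED SOCKET (world level)**: the same from per-step constants `E₋ ≤ w.em(g_k)`, `E₊ ≤ w.ep(g_k)` with `B16.UVIneq (w.C P) k V E₋ E₊` pointwise —
the form in which the Cor.-3 chain's EXPLICIT constants (`B16Cor3CurlyGas`: `E₋ = C·c_Γ + c_L + π_c·b`, `E₊ = … + M⁻⁴K₀Σe^{−c_i}`) are consumed —, GIVEN the
sign convention `χ_k ≥ 0` of the construction (`B16.uvIneq_of_le`). [cite: Balaban1989LargeFieldII, (0.1) pp.355–356 («E₋, E₊ independent of k, T_η, U_k»), p.387] -/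
theorem uvSlot_of_dominated {γ₁ : ℝ} (hγ : w.γ ≤ γ₁) (hχ : ∀ k, k ≤ P.K → ∀ V : (w.C P).Cfg k, 0 ≤ (w.C P).χ k V)
    (hUV : (w.C P).flow.InInterval γ₁ P.K → ∀ k, k ≤ P.K → (w.C P).Sect2Form k →
      ∃ Em Ep : ℝ, Em ≤ w.em ((w.C P).flow.g k) ∧ Ep ≤ w.ep ((w.C P).flow.g k) ∧ ∀ V : (w.C P).Cfg k, B16.UVIneq (w.C P) k V Em Ep) :
    ((leavesP w P).smallCouplings → (leavesP w P).densitiesDescribed) →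
      ((leavesP w P).smallCouplings → (leavesP w P).uvBounds) := by
  refine uvSlot_of_direct w P hγ fun hsc k hk hs V => ?_
  obtain ⟨Em, Ep, hm, hp, h⟩ := hUV hsc k hk hs
  exact B16.uvIneq_of_le (w.C P) k V (hχ k hk V) (h V) hm hp

/-- **N13 at `(w, P)` from the 𝐑-leaf and the direct pointwise (0.1) at `w.C P`** (any binding; the nine in-edge antecedents unused).
[cite: Balaban1989LargeFieldII, Thm 1 p.355, (0.1) p.356, p.387, p.391] -/
theorem b16_main_of_rOperation_of_direct (hR : (w.up P).rOperation) {γ₁ : ℝ} (hγ : w.γ ≤ γ₁)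
    (hUV : (w.C P).flow.InInterval γ₁ P.K → ∀ k, k ≤ P.K → (w.C P).Sect2Form k → ∀ V : (w.C P).Cfg k,
      B16.UVIneq (w.C P) k V (w.em ((w.C P).flow.g k)) (w.ep ((w.C P).flow.g k))) :
    Dag.B16_main (leavesP w P) :=
  b16_main_of_rOperation_of_uvSlot w P hR (uvSlot_of_direct w P hγ hUV)

/-- **N13 at `(w, P)` from the 𝐑-leaf and dominated pointwise constants**, given `χ_k ≥ 0`. [cite: Balaban1989LargeFieldII, Thm 1 p.355, (0.1) p.356, p.387] -/
theorem b16_main_of_rOperation_of_dominated (hR : (w.up P).rOperation) {γ₁ : ℝ} (hγ : w.γ ≤ γ₁)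
    (hχ : ∀ k, k ≤ P.K → ∀ V : (w.C P).Cfg k, 0 ≤ (w.C P).χ k V)
    (hUV : (w.C P).flow.InInterval γ₁ P.K → ∀ k, k ≤ P.K → (w.C P).Sect2Form k →
      ∃ Em Ep : ℝ, Em ≤ w.em ((w.C P).flow.g k) ∧ Ep ≤ w.ep ((w.C P).flow.g k) ∧ ∀ V : (w.C P).Cfg k, B16.UVIneq (w.C P) k V Em Ep) :
    Dag.B16_main (leavesP w P) :=
  b16_main_of_rOperation_of_uvSlot w P hR (uvSlot_of_dominated w P hγ hχ hUV)

end World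

/-! ## §2. Over an ARBITRARY record predicate with the construction clause `Rec D w → w.C = D.C` -/

section AnyRecord

variable {F : T4Family} {N : ℕ} [NeZero N] (Rec : FiniteEpsData F (SU N) → WorldP → Prop)

/-- **N13 AT ONE RECORD WORLD from the 𝐑-leaf and the pointwise (0.1) AT THE DATUM'S CONSTRUCTION** (any record predicate whose worlds carry `w.C = D.C`):
the direct hypothesis is stated on `D.C` with the world's letters `w.γ ≤ γ₁`, `w.em`, `w.ep`. [cite: Balaban1989LargeFieldII, Thm 1 p.355, (0.1) p.356, p.387, p.391] -/
theorem b16_main_at_record_of_direct (hRecC : ∀ D w, Rec D w → w.C = D.C) {D : FiniteEpsData F (SU N)} {w : WorldP} (h : Rec D w)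
    (P : B12.RunParams) (hR : (w.up P).rOperation) {γ₁ : ℝ} (hγ : w.γ ≤ γ₁)
    (hUV : (D.C P).flow.InInterval γ₁ P.K → ∀ k, k ≤ P.K → (D.C P).Sect2Form k → ∀ V : (D.C P).Cfg k,
      B16.UVIneq (D.C P) k V (w.em ((D.C P).flow.g k)) (w.ep ((D.C P).flow.g k))) :
    Dag.B16_main (leavesP w P) := by
  have hC : w.C = D.C := hRecC D w h
  obtain ⟨C, γ, em, ep, βup, β₀, β₀_pos, b, b_pos, L, one_lt_L, gR, up⟩ := w
  cases hC
  exact b16_main_of_rOperation_of_direct _ P hR hγ hUV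

/-- **THE THRESHOLD `S_N13E` SHAPE OVER AN ARBITRARY RECORD PREDICATE — this seat's recommended child text for N13** ([III] Cor. 3 p. 264: *"Under the
assumptions of Theorem 1 there exist constants E₋, E₊ independent of η and T, but depending on g_k"* — chosen AFTER the datum (its construction
constants), valid BELOW Theorem 1's threshold, BEFORE the world's letters and the run): for every record predicate `Rec` whose worlds carry the datum's
construction, from (R) the 𝐑-leaf at every record world ([Balaban1989LargeFieldII] Thm 1's delivery of [III] p. 244's assumed 𝐑) and (UV) datum-indexed
thresholds `γ₁ D > 0` and exponent functions `e∓ D` with the POINTWISE (0.1) at `D.C` — every run, interval hypothesis on `]0, γ₁ D]`, every `k ≤ K` under the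
§2-description guard, every configuration — it follows that
`∀ D, (∃ w, Rec D w) → ∃ γ₁ > 0, ∃ em ep, ∀ w, Rec D w → w.γ ≤ γ₁ → w.em = em → w.ep = ep → ∀ P, Dag.B16_main (leavesP w P)`.
Both (R) and (UV) are HYPOTHESES (the paper's content); count-neutral. [cite: Balaban1989LargeFieldII, Thm 1 p.355, (0.1) pp.355–356, p.387, p.391; Balaban1988Convergent, p.244, Cor. 3 (2.50) p.264] -/
theorem s_N13E_threshold_shape_of_direct (hRecC : ∀ D w, Rec D w → w.C = D.C)
    (γ₁ : FiniteEpsData F (SU N) → ℝ) (hγ₁ : ∀ D, 0 < γ₁ D) (eM eP : FiniteEpsData F (SU N) → ℝ → ℝ)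
    (hR : ∀ D w, Rec D w → ∀ P : B12.RunParams, (w.up P).rOperation)
    (hUV : ∀ D, (∃ w, Rec D w) → ∀ P : B12.RunParams, (D.C P).flow.InInterval (γ₁ D) P.K →
      ∀ k, k ≤ P.K → (D.C P).Sect2Form k → ∀ V : (D.C P).Cfg k,
        B16.UVIneq (D.C P) k V (eM D ((D.C P).flow.g k)) (eP D ((D.C P).flow.g k))) :
    ∀ D : FiniteEpsData F (SU N), (∃ w : WorldP, Rec D w) →
      ∃ γ' : ℝ, 0 < γ' ∧ ∃ em ep : ℝ → ℝ, ∀ w : WorldP, Rec D w → w.γ ≤ γ' → w.em = em → w.ep = ep →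
        ∀ P : B12.RunParams, Dag.B16_main (leavesP w P) := by
  intro D hD
  refine ⟨γ₁ D, hγ₁ D, eM D, eP D, fun w h hγ hem hep P => ?_⟩
  refine b16_main_at_record_of_direct Rec hRecC h P (hR D w h P) hγ fun hsc k hk hs V => ?_
  rw [hem, hep]
  exact hUV D hD P hsc k hk hs V

/-- **The threshold shape from DOMINATED constants**: (UV) replaced by per-step explicit constants `E₋ ≤ eM D (g_k)`, `E₊ ≤ eP D (g_k)` with the pointwise (0.1)
`∀ V, B16.UVIneq (D.C P) k V E₋ E₊` — the Cor.-3 chain's output verbatim —, given the sign convention `B16.SignConventions D.C` (`χ_k ≥ 0`; a theorem of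
record from NODE 00 Stage 7 on, where `χ_k = chiOfRecord ∈ [0, 1]`). [cite: Balaban1989LargeFieldII, Thm 1 p.355, (0.1) pp.355–356, p.387; Balaban1988Convergent, Cor. 3 (2.50) p.264] -/
theorem s_N13E_threshold_shape_of_dominated (hRecC : ∀ D w, Rec D w → w.C = D.C)
    (γ₁ : FiniteEpsData F (SU N) → ℝ) (hγ₁ : ∀ D, 0 < γ₁ D) (eM eP : FiniteEpsData F (SU N) → ℝ → ℝ)
    (hR : ∀ D w, Rec D w → ∀ P : B12.RunParams, (w.up P).rOperation)
    (hsign : ∀ D, (∃ w, Rec D w) → B16.SignConventions D.C)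
    (hUV : ∀ D, (∃ w, Rec D w) → ∀ P : B12.RunParams, (D.C P).flow.InInterval (γ₁ D) P.K →
      ∀ k, k ≤ P.K → (D.C P).Sect2Form k →
        ∃ Em Ep : ℝ, Em ≤ eM D ((D.C P).flow.g k) ∧ Ep ≤ eP D ((D.C P).flow.g k) ∧ ∀ V : (D.C P).Cfg k, B16.UVIneq (D.C P) k V Em Ep) :
    ∀ D : FiniteEpsData F (SU N), (∃ w : WorldP, Rec D w) →
      ∃ γ' : ℝ, 0 < γ' ∧ ∃ em ep : ℝ → ℝ, ∀ w : WorldP, Rec D w → w.γ ≤ γ' → w.em = em → w.ep = ep →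
        ∀ P : B12.RunParams, Dag.B16_main (leavesP w P) := by
  refine s_N13E_threshold_shape_of_direct Rec hRecC γ₁ hγ₁ eM eP hR fun D hD P hsc k hk hs V => ?_
  obtain ⟨Em, Ep, hm, hp, h⟩ := hUV D hD P hsc k hk hs
  exact B16.uvIneq_of_le (D.C P) k V (hsign D hD P k V) (h V) hm hp

end AnyRecord

/-! ## §3. At the predicate of record `IsRecordOfRecord₅C` -/

section AtRecord5C

variable {F : T4Family} {N : ℕ} [NeZero N]

/-- (R) at the predicate of record from (R₅): if [III] p. 244's property holds for the RESIDUAL 𝐑-carrier `θ.res.V P` of every admissible Stage-5 parameter,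
then the 𝐑-leaf holds at every run of every `IsRecordOfRecord₅C`-world (`B16NodeKnitRecord5C.rOperation_iff_rOpLeaf_res₅C`). [cite: Balaban1988Convergent, p.244; Balaban1989LargeFieldII, Thm 1 p.355 + p.391] -/
theorem rOperation_of_isRecordOfRecord₅C
    (hR5 : ∀ θ : Stage5Params F N, θ.Admissible → ∀ P : B12.RunParams, ROpLeaf (θ.res.V P))
    {D : FiniteEpsData F (SU N)} {w : WorldP} (h : IsRecordOfRecord₅C F N D w) (P : B12.RunParams) : (w.up P).rOperation := by
  obtain ⟨θ, hθ, -, -, -, -, hup⟩ := h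
  exact (rOperation_iff_rOpLeaf_res₅C F N θ w P (hup P)).2 (hR5 θ hθ P)

/-- **THE THRESHOLD `S_N13E Rec₅C` SHAPE FROM (R₅) AND THE POINTWISE (0.1) AT THE DATUM'S CONSTRUCTION** (§2 at `Rec := IsRecordOfRecord₅C F N`, construction
clause `Node00.construction_eq_of_isRecordOfRecord₅C`): the socket the Cor.-3 chain's one-run-one-step output plugs into, datum by datum.
[cite: Balaban1989LargeFieldII, Thm 1 p.355, (0.1) pp.355–356, p.387, p.391; Balaban1988Convergent, p.244, Cor. 3 (2.50) p.264] -/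
theorem s_N13E_threshold_shape_of_direct₅C_at_datum (γ₁ : FiniteEpsData F (SU N) → ℝ) (hγ₁ : ∀ D, 0 < γ₁ D)
    (eM eP : FiniteEpsData F (SU N) → ℝ → ℝ)
    (hR5 : ∀ θ : Stage5Params F N, θ.Admissible → ∀ P : B12.RunParams, ROpLeaf (θ.res.V P))
    (hUV : ∀ D, (∃ w, IsRecordOfRecord₅C F N D w) → ∀ P : B12.RunParams, (D.C P).flow.InInterval (γ₁ D) P.K →
      ∀ k, k ≤ P.K → (D.C P).Sect2Form k → ∀ V : (D.C P).Cfg k,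
        B16.UVIneq (D.C P) k V (eM D ((D.C P).flow.g k)) (eP D ((D.C P).flow.g k))) :
    ∀ D : FiniteEpsData F (SU N), (∃ w : WorldP, IsRecordOfRecord₅C F N D w) →
      ∃ γ' : ℝ, 0 < γ' ∧ ∃ em ep : ℝ → ℝ, ∀ w : WorldP, IsRecordOfRecord₅C F N D w → w.γ ≤ γ' → w.em = em → w.ep = ep →
        ∀ P : B12.RunParams, Dag.B16_main (leavesP w P) :=
  s_N13E_threshold_shape_of_direct (IsRecordOfRecord₅C F N) (fun _ _ h => construction_eq_of_isRecordOfRecord₅C h) γ₁ hγ₁ eM eP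
    (fun _ _ h P => rOperation_of_isRecordOfRecord₅C hR5 h P) hUV

/-- **… and from DOMINATED constants**, given the sign convention of the datum's construction (`B16.SignConventions D.C`, χ_k ≥ 0).
[cite: Balaban1989LargeFieldII, Thm 1 p.355, (0.1) pp.355–356, p.387; Balaban1988Convergent, p.244, Cor. 3 (2.50) p.264] -/
theorem s_N13E_threshold_shape_of_dominated₅C_at_datum (γ₁ : FiniteEpsData F (SU N) → ℝ) (hγ₁ : ∀ D, 0 < γ₁ D)
    (eM eP : FiniteEpsData F (SU N) → ℝ → ℝ)
    (hR5 : ∀ θ : Stage5Params F N, θ.Admissible → ∀ P : B12.RunParams, ROpLeaf (θ.res.V P))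
    (hsign : ∀ D, (∃ w, IsRecordOfRecord₅C F N D w) → B16.SignConventions D.C)
    (hUV : ∀ D, (∃ w, IsRecordOfRecord₅C F N D w) → ∀ P : B12.RunParams, (D.C P).flow.InInterval (γ₁ D) P.K →
      ∀ k, k ≤ P.K → (D.C P).Sect2Form k →
        ∃ Em Ep : ℝ, Em ≤ eM D ((D.C P).flow.g k) ∧ Ep ≤ eP D ((D.C P).flow.g k) ∧ ∀ V : (D.C P).Cfg k, B16.UVIneq (D.C P) k V Em Ep) :
    ∀ D : FiniteEpsData F (SU N), (∃ w : WorldP, IsRecordOfRecord₅C F N D w) →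
      ∃ γ' : ℝ, 0 < γ' ∧ ∃ em ep : ℝ → ℝ, ∀ w : WorldP, IsRecordOfRecord₅C F N D w → w.γ ≤ γ' → w.em = em → w.ep = ep →
        ∀ P : B12.RunParams, Dag.B16_main (leavesP w P) :=
  s_N13E_threshold_shape_of_dominated (IsRecordOfRecord₅C F N) (fun _ _ h => construction_eq_of_isRecordOfRecord₅C h) γ₁ hγ₁ eM eP
    (fun _ _ h P => rOperation_of_isRecordOfRecord₅C hR5 h P) hsign hUV

end AtRecord5C

/-! ## §4. Fitness of the recommended child: the design-E glue closes binder B2 WITH THE THRESHOLD `S_N13E` (kernel check; the glue of record is N24's) -/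

section Fitness

variable {F : T4Family} {N : ℕ} [NeZero N] (Rec : FiniteEpsData F (SU N) → WorldP → Prop)

/-- **FITNESS CHECK OF THE RECOMMENDED CHILD** (design E with threshold; cf. the dagwriter's `B2_at_recordE`, whose N13 input has no threshold): over ANY
record predicate that (a) binds the construction (`Rec D w → w.C = D.C`) and (b) is RE-LETTERABLE — closed under replacing the world's five conclusion
letters `(γ, b, β⁺, e₋, e₊)` (any `γ`, any `b > 0`) —, binder B2 `B16.EndStatementBPrinted D.C` holds at every record from: N01–N12 at every run of every
record world; the THRESHOLD child `∀ D, (∃ w, Rec D w) → ∃ γ₁ > 0, ∃ e₋ e₊, ∀ w, Rec D w → w.γ ≤ γ₁ → w.em = e₋ → w.ep = e₊ → ∀ P, N13`; the β-window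
existential at the datum `∃ γ₀ b β⁺, 0 < γ₀ ∧ 0 < b ∧ BetaBoundsInInterval D.C γ₀ b β⁺` (the dagwriter's `RenormalisationBetaE` β-part); and (0.20) along
in-interval runs of every record world (a theorem at `IsRecordOfRecord₅C`).  Proof: re-letter the world to `γ := min γ₀ γ₁`, `(b, β⁺, e₋, e₊)` := the
witnesses — again a record world, so N01–N12, (0.20) and, by the child, N13 hold there — and apply the END headline
`Node00.endStatementBPrinted_of_nodesP_interval_guarded` (`w.γ ≤ γ₀` accepts `min γ₀ γ₁`).  Pure logic; every input a HYPOTHESIS; count-neutral.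
[cite: Balaban1989LargeFieldII, Thm 1 p.355 + p.391; Balaban1988Convergent, Cor. 3 (2.50) p.264 («Under the assumptions of Theorem 1 there exist constants E₋, E₊»)] -/
theorem endStatementBPrinted_at_record_of_threshold_child (hRecC : ∀ D w, Rec D w → w.C = D.C)
    (hRel : ∀ (D : FiniteEpsData F (SU N)) (w : WorldP) (γ b βup : ℝ) (em ep : ℝ → ℝ) (hb : 0 < b), 0 < γ → Rec D w →
      Rec D { w with γ := γ, b := b, b_pos := hb, βup := βup, em := em, ep := ep })
    (h12 : ∀ D w, Rec D w → ∀ P : B12.RunParams,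
      Dag.B4_main (leavesP w P) ∧ Dag.B5_main (leavesP w P) ∧ Dag.B6_main (leavesP w P) ∧ Dag.B7_main (leavesP w P) ∧
      Dag.B8_main (leavesP w P) ∧ Dag.B9_main (leavesP w P) ∧ Dag.B10_main (leavesP w P) ∧ Dag.B11_main (leavesP w P) ∧
      Dag.B12_main (leavesP w P) ∧ Dag.B13_main (leavesP w P) ∧ Dag.B14_main (leavesP w P) ∧ Dag.B15_main (leavesP w P))
    (h13 : ∀ D, (∃ w, Rec D w) → ∃ γ₁ : ℝ, 0 < γ₁ ∧ ∃ em ep : ℝ → ℝ, ∀ w, Rec D w → w.γ ≤ γ₁ → w.em = em → w.ep = ep →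
      ∀ P : B12.RunParams, Dag.B16_main (leavesP w P))
    (hβ : ∀ D, (∃ w, Rec D w) → ∃ γ₀ b βup : ℝ, 0 < γ₀ ∧ 0 < b ∧ BetaBoundsInInterval D.C.toB12 γ₀ b βup)
    (hrg : ∀ D w, Rec D w → ∀ P : B12.RunParams, (leavesP w P).smallCouplings → (leavesP w P).rgFlow) :
    ∀ (D : FiniteEpsData F (SU N)) (w : WorldP), Rec D w → B16.EndStatementBPrinted D.C := by
  intro D w h
  obtain ⟨γ₁, hγ₁, em, ep, h16⟩ := h13 D ⟨w, h⟩
  obtain ⟨γ₀, b, βup, hγ₀, hb, hβ'⟩ := hβ D ⟨w, h⟩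
  have h' : Rec D { w with γ := min γ₀ γ₁, b := b, b_pos := hb, βup := βup, em := em, ep := ep } :=
    hRel D w (min γ₀ γ₁) b βup em ep hb (lt_min hγ₀ hγ₁) h
  have hC' : ({ w with γ := min γ₀ γ₁, b := b, b_pos := hb, βup := βup, em := em, ep := ep } : WorldP).C = D.C := hRecC D _ h'
  rw [← hC']
  refine endStatementBPrinted_of_nodesP_interval_guarded _ (lt_min hγ₀ hγ₁) (min_le_left γ₀ γ₁) (fun P => ?_) (hrg D _ h') ?_
  · obtain ⟨h4, h5, h6, h7, h8, h9, h10, h11, h12', h13', h14, h15⟩ := h12 D _ h' P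
    exact ⟨h4, h5, h6, h7, h8, h9, h10, h11, h12', h13', h14, h15, h16 _ h' (min_le_right γ₀ γ₁) rfl rfl P⟩
  · rw [hC']
    exact hβ'

/-- **`IsRecordOfRecord₅C` is re-letterable** in all five conclusion letters `(γ, b, β⁺, e₋, e₊)` (`γ > 0`; `b > 0` carried by the world): the predicate of
record reads `w.C`, `w.γ` (= `θ.γ`, any positive value over one datum — module 6's `isRecordOfRecord₅C_withGamma`), `w.L` and `w.up` only.
[cite: Balaban1989LargeFieldII, Thm 1 p.355; Balaban1988Convergent, Cor. 3 (2.50) p.264 (the letters are CONCLUSION constants; bookkeeping)] -/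
theorem isRecordOfRecord₅C_withLetters {D : FiniteEpsData F (SU N)} {w : WorldP} (γ b βup : ℝ) (em ep : ℝ → ℝ) (hb : 0 < b)
    (hγ : 0 < γ) (h : IsRecordOfRecord₅C F N D w) :
    IsRecordOfRecord₅C F N D { w with γ := γ, b := b, b_pos := hb, βup := βup, em := em, ep := ep } := by
  obtain ⟨θ, hθ, hD, hC, -, hL, hup⟩ := h
  exact ⟨{ θ with γ := γ }, ⟨hθ.1, hγ⟩, hD.trans (B16NodeKnitRecord5.datumOfRecord₅_withGamma θ γ).symm, hC, rfl, hL,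
    fun P => (hup P).trans (B16NodeKnitRecord5C.upOfRecord₅C_withGamma θ γ P).symm⟩

/-- **At the predicate of record**: binder B2 `B16.EndStatementBPrinted D.C` at every `IsRecordOfRecord₅C`-record from N01–N12 at every run of every record
world, the THRESHOLD `S_N13E` child, and the β-window existential at the datum — (0.20) along in-interval runs and re-letterability being THEOREMS of the
predicate (`Node00.rgFlow_of_smallCouplings_of_isRecordOfRecord₅C`, `isRecordOfRecord₅C_withLetters`).  Fitness check of this seat's recommended N13 child
against N24's glue shape; the children and the β-window are HYPOTHESES; count-neutral. [cite: Balaban1989LargeFieldII, Thm 1 p.355 + p.391; Balaban1988Convergent, Cor. 3 (2.50) p.264] -/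
theorem endStatementBPrinted_of_isRecordOfRecord₅C_of_threshold_child
    (h12 : ∀ (D : FiniteEpsData F (SU N)) (w : WorldP), IsRecordOfRecord₅C F N D w → ∀ P : B12.RunParams,
      Dag.B4_main (leavesP w P) ∧ Dag.B5_main (leavesP w P) ∧ Dag.B6_main (leavesP w P) ∧ Dag.B7_main (leavesP w P) ∧
      Dag.B8_main (leavesP w P) ∧ Dag.B9_main (leavesP w P) ∧ Dag.B10_main (leavesP w P) ∧ Dag.B11_main (leavesP w P) ∧
      Dag.B12_main (leavesP w P) ∧ Dag.B13_main (leavesP w P) ∧ Dag.B14_main (leavesP w P) ∧ Dag.B15_main (leavesP w P))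
    (h13 : ∀ D : FiniteEpsData F (SU N), (∃ w, IsRecordOfRecord₅C F N D w) → ∃ γ₁ : ℝ, 0 < γ₁ ∧ ∃ em ep : ℝ → ℝ,
      ∀ w, IsRecordOfRecord₅C F N D w → w.γ ≤ γ₁ → w.em = em → w.ep = ep → ∀ P : B12.RunParams, Dag.B16_main (leavesP w P))
    (hβ : ∀ D : FiniteEpsData F (SU N), (∃ w, IsRecordOfRecord₅C F N D w) →
      ∃ γ₀ b βup : ℝ, 0 < γ₀ ∧ 0 < b ∧ BetaBoundsInInterval D.C.toB12 γ₀ b βup) :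
    ∀ (D : FiniteEpsData F (SU N)) (w : WorldP), IsRecordOfRecord₅C F N D w → B16.EndStatementBPrinted D.C :=
  endStatementBPrinted_at_record_of_threshold_child (IsRecordOfRecord₅C F N) (fun _ _ h => construction_eq_of_isRecordOfRecord₅C h)
    (fun _ _ γ b βup em ep hb hγ h => isRecordOfRecord₅C_withLetters γ b βup em ep hb hγ h) h12 h13 hβ
    (fun _ _ h P hsc => rgFlow_of_smallCouplings_of_isRecordOfRecord₅C h P hsc)

end Fitness

end Literature.MathematicalPhysics.QuantumFieldTheory.Balaban1983to89.B16NodeKnitSocket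

end
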